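import Summits.AtomisticToContinuum.HydrodynamicLimit.Theorems.AntiMazurCoboundariesKineticWindowGronwallProductKineticInstanceSplit
import Literature.MathematicalPhysics.KineticTheory.HardSphereEulerProofs
import HarnessLib

/-!
# Family glue, file 1: window monotonicity, the inequality form of arithmetic-mean Jensen, and the
# pointwise comparison of thermal-frame product observables between two nearby frames

Crux `Summit.AtomisticToContinuum.HydrodynamicLimit.Theses.AntiMazurCoboundaries.KineticWindowGronwall`
(stmt-AtomisticToContinuum-9282), skeleton line `rare-band-ladder-dock` v7, toward the registered stub
`stub_familyGlue : FamilyGlue` (`LocalQuadraticWindowLDBounds → LocalQuadraticWindowLDFamily`: window-LD thresholds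
pointwise in the local Gibbs profile upgrade to thresholds uniform along jointly continuous families of profiles).

* §1 `windowSum_mono`, `lintegral_exp_window_le_of_le_avg` — the window functional `Σᵢ w⁻¹∫₀ʷ q(Φ_r z i) dr` is
  monotone in the one-body observable on good orbits, and the INEQUALITY form of the landed rank split
  (`KineticWindowGronwallProductKineticInstance.lintegral_exp_window_avg_le`): if `β q ≤ (card)⁻¹ Σₘ qₘ` pointwise then the
  window exponential moment of `β q` is bounded by any common bound of those of the `qₘ`.
* §2 `lintegral_le_of_forall_measurable` — an a.e.-measurable functional inherits a change-of-measure inequality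
  stated for measurable ones (both laws absolutely continuous w.r.t. a common reference).
* §3 frame kinematics (`one_add_norm_sq_frame_le`, `one_add_norm_sq_le_frame`, `norm_frame_sub_frame_le`) and the pointwise
  comparison `observable_compare` / `observable_compare_avg`: for two frames `(θ, u)`, `(θ', u')` at a point, within a
  temperature range `[θm, θM]` and drift bound `U`, close in the sense `|(√θ)⁻¹ − (√θ')⁻¹| ≤ κ₁`, `‖u − u'‖ ≤ κ`, weights
  `|a − a'| ≤ ω`, `|a'| ≤ 1`, a continuous `g` of quadratic growth `c` with modulus `η` at tolerance `κ'` on the bulk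
  ball, and a radial tail cut-off `t ≥ 0` equal to `1 + ‖w‖²` beyond `R`:
  `a g(w̃) − a' g(w̃') ≤ (ω c C₂ + η)(1 + ‖v‖²) + 2 c C₂ C₃ t(w̃')`, `w̃ = (v − u)/√θ`, `w̃' = (v − u')/√θ'`.
-/

noncomputable section

namespace Summit.AtomisticToContinuum.HydrodynamicLimit.Theorems.KineticWindowGronwallFamilyGlue

open MeasureTheory Set Filter
open scoped ENNReal BigOperators
open Literature.Analysis.FluidPDE Literature.MathematicalPhysics.KineticTheory

/-! ## §1 Window monotonicity and the inequality form of arithmetic-mean Jensen -/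

section Flow

variable {n : ℕ} {ε : ℝ} (Φ : HardSphereFlow (Torus.geometry (Fin 3)) ε n)

/-- **Monotonicity of the window functional on a good orbit**: for continuous one-body `q ≤ q'` and `w ≥ 0`,
`Σᵢ w⁻¹∫₀ʷ q(Φ_r z i) dr ≤ Σᵢ w⁻¹∫₀ʷ q'(Φ_r z i) dr`. [folklore] -/
theorem windowSum_mono {z : Config n (Fin 3) T3} (hz : z ∈ Φ.good) {q q' : T3 × V3 → ℝ}
    (hq : Continuous q) (hq' : Continuous q') (hle : ∀ y, q y ≤ q' y) {w : ℝ} (hw : 0 ≤ w) :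
    ∑ i, w⁻¹ * ∫ r in (0 : ℝ)..w, q (Φ.flow r z i) ≤ ∑ i, w⁻¹ * ∫ r in (0 : ℝ)..w, q' (Φ.flow r z i) := by
  refine Finset.sum_le_sum fun i _ => mul_le_mul_of_nonneg_left ?_ (inv_nonneg.2 hw)
  exact intervalIntegral.integral_mono_on hw
    (Φ.intervalIntegrable_comp_flow_of_continuous hz (hq.comp (continuous_apply i)) 0 w)
    (Φ.intervalIntegrable_comp_flow_of_continuous hz (hq'.comp (continuous_apply i)) 0 w)
    fun r _ => hle _

/-- **Inequality form of the rank split.** For a law `P` carried by the good set, continuous one-body `q`, `qₘ`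
(nonempty finite index), `β ≥ 0` with `β q ≤ (card)⁻¹ Σₘ qₘ` pointwise and a window `w ≥ 0`: if every
`∫⁻ exp(Σᵢ w⁻¹∫₀ʷ qₘ(Φ_r z i)) dP ≤ B` then `∫⁻ exp(β Σᵢ w⁻¹∫₀ʷ q(Φ_r z i)) dP ≤ B`. [folklore] -/
theorem lintegral_exp_window_le_of_le_avg {P : Measure (Config n (Fin 3) T3)} (hP : P Φ.goodᶜ = 0)
    {ι : Type*} [Fintype ι] [Nonempty ι] {q : T3 × V3 → ℝ} {qm : ι → T3 × V3 → ℝ}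
    (hq : Continuous q) (hqm : ∀ m, Continuous (qm m)) {β : ℝ}
    (hle : ∀ y, β * q y ≤ (Fintype.card ι : ℝ)⁻¹ * ∑ m, qm m y) {w : ℝ} (hw : 0 ≤ w) {B : ℝ≥0∞}
    (hB : ∀ m, ∫⁻ z, ENNReal.ofReal (Real.exp (∑ i, w⁻¹ * ∫ r in (0 : ℝ)..w, qm m (Φ.flow r z i))) ∂P ≤ B) :
    ∫⁻ z, ENNReal.ofReal (Real.exp (β * ∑ i, w⁻¹ * ∫ r in (0 : ℝ)..w, q (Φ.flow r z i))) ∂P ≤ B := by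
  -- the average observable and the equality version
  set qa : T3 × V3 → ℝ := fun y => (Fintype.card ι : ℝ)⁻¹ * ∑ m, qm m y with hqa
  have hqac : Continuous qa := continuous_const.mul (continuous_finsetSum _ fun m _ => hqm m)
  have hβq : Continuous fun y => β * q y := continuous_const.mul hq
  have havg := KineticWindowGronwallProductKineticInstance.lintegral_exp_window_avg_le Φ hP qa hqm 1
    (fun y => by rw [one_mul]) w hB
  refine le_trans (lintegral_mono_ae ?_) havg
  filter_upwards [(mem_ae_iff.mpr hP : ∀ᵐ z ∂P, z ∈ Φ.good)] with z hz
  refine ENNReal.ofReal_le_ofReal (Real.exp_le_exp.2 ?_)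
  rw [one_mul]
  -- `β S(q) = S(β q) ≤ S(qa)` on the good orbit
  have h1 : β * ∑ i, w⁻¹ * ∫ r in (0 : ℝ)..w, q (Φ.flow r z i) =
      ∑ i, w⁻¹ * ∫ r in (0 : ℝ)..w, β * q (Φ.flow r z i) := by
    rw [Finset.mul_sum]
    refine Finset.sum_congr rfl fun i _ => ?_
    rw [intervalIntegral.integral_const_mul]
    ring
  rw [h1]
  exact windowSum_mono Φ hz hβq hqac hle hw

/-- **Three-piece form of the inequality rank split** (the shape used by the family glue): if
`β q ≤ 3⁻¹ (q₁ + q₂ + q₃)` pointwise for continuous one-body observables and each of the three window exponential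
moments is `≤ B`, then so is that of `β q`. [folklore] -/
theorem lintegral_exp_window_le_of_le_three {P : Measure (Config n (Fin 3) T3)} (hP : P Φ.goodᶜ = 0)
    {q q₁ q₂ q₃ : T3 × V3 → ℝ} (hq : Continuous q) (hq₁ : Continuous q₁) (hq₂ : Continuous q₂)
    (hq₃ : Continuous q₃) {β : ℝ} (hle : ∀ y, β * q y ≤ (3 : ℝ)⁻¹ * (q₁ y + q₂ y + q₃ y)) {w : ℝ} (hw : 0 ≤ w)
    {B : ℝ≥0∞}
    (hB₁ : ∫⁻ z, ENNReal.ofReal (Real.exp (∑ i, w⁻¹ * ∫ r in (0 : ℝ)..w, q₁ (Φ.flow r z i))) ∂P ≤ B)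
    (hB₂ : ∫⁻ z, ENNReal.ofReal (Real.exp (∑ i, w⁻¹ * ∫ r in (0 : ℝ)..w, q₂ (Φ.flow r z i))) ∂P ≤ B)
    (hB₃ : ∫⁻ z, ENNReal.ofReal (Real.exp (∑ i, w⁻¹ * ∫ r in (0 : ℝ)..w, q₃ (Φ.flow r z i))) ∂P ≤ B) :
    ∫⁻ z, ENNReal.ofReal (Real.exp (β * ∑ i, w⁻¹ * ∫ r in (0 : ℝ)..w, q (Φ.flow r z i))) ∂P ≤ B := by
  refine lintegral_exp_window_le_of_le_avg Φ hP (ι := Fin 3) (qm := ![q₁, q₂, q₃]) hq ?_ ?_ hw ?_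
  · intro m
    fin_cases m
    · exact hq₁
    · exact hq₂
    · exact hq₃
  · intro y
    have h3 : (Fintype.card (Fin 3) : ℝ)⁻¹ * ∑ m, (![q₁, q₂, q₃] : Fin 3 → T3 × V3 → ℝ) m y =
        (3 : ℝ)⁻¹ * (q₁ y + q₂ y + q₃ y) := by
      simp only [Fintype.card_fin, Nat.cast_ofNat, Fin.sum_univ_three, Matrix.cons_val_zero, Matrix.cons_val_one,
        Matrix.cons_val_two, Matrix.tail_cons, Matrix.head_cons]
    rw [h3]
    exact hle y
  · intro m
    fin_cases m
    · exact hB₁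
    · exact hB₂
    · exact hB₃

end Flow

/-! ## §2 A change-of-measure inequality passes to a.e.-measurable functionals -/

/-- If `μ₁, μ₂ ≪ L`, `G` is `L`-a.e. measurable and `∫ G' dμ₁ ≤ A (∫ G'^2 dμ₂)^{1/2}` for every MEASURABLE `G'`, then
the same holds for `G`. [folklore] -/
theorem lintegral_le_of_forall_measurable {Ω : Type*} [MeasurableSpace Ω] {L μ₁ μ₂ : Measure Ω}
    (h₁ : μ₁ ≪ L) (h₂ : μ₂ ≪ L) {A : ℝ≥0∞}
    (H : ∀ G' : Ω → ℝ≥0∞, Measurable G' → ∫⁻ z, G' z ∂μ₁ ≤ A * (∫⁻ z, G' z ^ (2 : ℝ) ∂μ₂) ^ (1 / 2 : ℝ))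
    {G : Ω → ℝ≥0∞} (hG : AEMeasurable G L) :
    ∫⁻ z, G z ∂μ₁ ≤ A * (∫⁻ z, G z ^ (2 : ℝ) ∂μ₂) ^ (1 / 2 : ℝ) := by
  have hae : G =ᵐ[L] hG.mk G := hG.ae_eq_mk
  have hae1 : G =ᵐ[μ₁] hG.mk G := h₁.ae_le hae
  have hae2 : G =ᵐ[μ₂] hG.mk G := h₂.ae_le hae
  have e₁ : ∫⁻ z, G z ∂μ₁ = ∫⁻ z, hG.mk G z ∂μ₁ := lintegral_congr_ae hae1
  have e₂ : ∫⁻ z, G z ^ (2 : ℝ) ∂μ₂ = ∫⁻ z, hG.mk G z ^ (2 : ℝ) ∂μ₂ := by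
    refine lintegral_congr_ae ?_
    filter_upwards [hae2] with z hz
    rw [hz]
  rw [e₁, e₂]
  exact H _ hG.measurable_mk

/-! ## §3 Frame kinematics and the pointwise comparison of product observables -/

/-- The growth transfer constant `C₂(θm, U) = 1 + 2U²/θm + 2/θm`: `1 + ‖(v − u)/√θ‖² ≤ C₂ (1 + ‖v‖²)` whenever
`θ ≥ θm`, `‖u‖ ≤ U`. -/
def C₂ (θm U : ℝ) : ℝ := 1 + 2 * U ^ 2 / θm + 2 / θm

/-- The inverse growth transfer constant `C₃(θM, U) = 1 + 2U² + 2θM`: `1 + ‖v‖² ≤ C₃ (1 + ‖(v − u)/√θ‖²)` whenever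
`0 < θ ≤ θM`, `‖u‖ ≤ U`. -/
def C₃ (θM U : ℝ) : ℝ := 1 + 2 * U ^ 2 + 2 * θM

/-- `C₂ ≥ 1`. -/
theorem one_le_C₂ {θm U : ℝ} (hθm : 0 < θm) : 1 ≤ C₂ θm U := by
  unfold C₂
  have h1 : 0 ≤ 2 * U ^ 2 / θm := by positivity
  have h2 : 0 ≤ 2 / θm := by positivity
  linarith

/-- `C₃ ≥ 1`. -/
theorem one_le_C₃ {θM U : ℝ} (hθM : 0 < θM) : 1 ≤ C₃ θM U := by
  unfold C₃; nlinarith [sq_nonneg U]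

/-- The squared norm of the scaled peculiar velocity: `‖(√θ)⁻¹ • (v − u)‖² = ‖v − u‖²/θ` (`θ > 0`). [folklore] -/
theorem norm_sq_frame {θ : ℝ} (hθ : 0 < θ) (u v : V3) :
    ‖(Real.sqrt θ)⁻¹ • (v - u)‖ ^ 2 = ‖v - u‖ ^ 2 / θ := by
  rw [norm_smul, mul_pow, norm_inv, Real.norm_eq_abs, abs_of_nonneg (Real.sqrt_nonneg θ), inv_pow,
    Real.sq_sqrt hθ.le]
  ring

/-- **Growth transfer, lab → frame**: `1 + ‖(v − u)/√θ‖² ≤ C₂(θm, U)(1 + ‖v‖²)` for `θ ≥ θm > 0`, `‖u‖ ≤ U`. [folklore] -/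
theorem one_add_norm_sq_frame_le {θm U θ : ℝ} (hθm : 0 < θm) (hθ : θm ≤ θ) {u : V3} (hu : ‖u‖ ≤ U) (v : V3) :
    1 + ‖(Real.sqrt θ)⁻¹ • (v - u)‖ ^ 2 ≤ C₂ θm U * (1 + ‖v‖ ^ 2) := by
  have hθ0 : 0 < θ := hθm.trans_le hθ
  have hU : 0 ≤ U := (norm_nonneg u).trans hu
  rw [norm_sq_frame hθ0]
  have h1 : ‖v - u‖ ≤ ‖v‖ + U := (norm_sub_le v u).trans (by linarith)
  have h2 : ‖v - u‖ ^ 2 ≤ 2 * ‖v‖ ^ 2 + 2 * U ^ 2 := by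
    nlinarith [norm_nonneg (v - u), norm_nonneg v, sq_nonneg (‖v‖ - U)]
  have h3 : ‖v - u‖ ^ 2 / θ ≤ (2 * ‖v‖ ^ 2 + 2 * U ^ 2) / θm :=
    (div_le_div_of_nonneg_left (sq_nonneg _) hθm hθ).trans (div_le_div_of_nonneg_right h2 hθm.le)
  unfold C₂
  rw [add_div] at h3
  have h4 : 2 * ‖v‖ ^ 2 / θm = 2 / θm * ‖v‖ ^ 2 := by ring
  have h5 : 0 ≤ 2 * U ^ 2 / θm * ‖v‖ ^ 2 := by positivity
  have h6 : 0 ≤ 2 / θm := by positivity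
  nlinarith [sq_nonneg ‖v‖]

/-- **Growth transfer, frame → lab**: `1 + ‖v‖² ≤ C₃(θM, U)(1 + ‖(v − u')/√θ'‖²)` for `0 < θ' ≤ θM`, `‖u'‖ ≤ U`. [folklore] -/
theorem one_add_norm_sq_le_frame {θM U θ' : ℝ} (hθ' : 0 < θ') (hθM : θ' ≤ θM) {u' : V3} (hu : ‖u'‖ ≤ U)
    (v : V3) :
    1 + ‖v‖ ^ 2 ≤ C₃ θM U * (1 + ‖(Real.sqrt θ')⁻¹ • (v - u')‖ ^ 2) := by
  have hU : 0 ≤ U := (norm_nonneg u').trans hu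
  rw [norm_sq_frame hθ']
  have h1 : ‖v‖ ≤ ‖v - u'‖ + U := by
    have := norm_le_norm_add_norm_sub' v u'
    have h' : ‖v‖ ≤ ‖v - u'‖ + ‖u'‖ := by
      calc ‖v‖ = ‖(v - u') + u'‖ := by rw [sub_add_cancel]
        _ ≤ ‖v - u'‖ + ‖u'‖ := norm_add_le _ _
    linarith
  have h2 : ‖v‖ ^ 2 ≤ 2 * ‖v - u'‖ ^ 2 + 2 * U ^ 2 := by
    nlinarith [norm_nonneg (v - u'), norm_nonneg v, sq_nonneg (‖v - u'‖ - U)]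
  have h3 : ‖v - u'‖ ^ 2 = θ' * (‖v - u'‖ ^ 2 / θ') := by field_simp
  have h4 : θ' * (‖v - u'‖ ^ 2 / θ') ≤ θM * (‖v - u'‖ ^ 2 / θ') :=
    mul_le_mul_of_nonneg_right hθM (by positivity)
  unfold C₃
  have h5 : 0 ≤ ‖v - u'‖ ^ 2 / θ' := by positivity
  nlinarith [sq_nonneg U]

/-- **Frame closeness**: `‖(v − u)/√θ − (v − u')/√θ'‖ ≤ κ₁ (‖v‖ + U) + κ/√θm` when `|(√θ)⁻¹ − (√θ')⁻¹| ≤ κ₁`,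
`‖u − u'‖ ≤ κ`, `‖u‖ ≤ U`, `θ' ≥ θm > 0`. [folklore] -/
theorem norm_frame_sub_frame_le {θm U θ θ' κ κ₁ : ℝ} (hθm : 0 < θm) (hθ' : θm ≤ θ') {u u' : V3} (hu : ‖u‖ ≤ U)
    (hκ₁ : |(Real.sqrt θ)⁻¹ - (Real.sqrt θ')⁻¹| ≤ κ₁) (hκ : ‖u - u'‖ ≤ κ) (v : V3) :
    ‖(Real.sqrt θ)⁻¹ • (v - u) - (Real.sqrt θ')⁻¹ • (v - u')‖ ≤ κ₁ * (‖v‖ + U) + κ / Real.sqrt θm := by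
  have hsm : 0 < Real.sqrt θm := Real.sqrt_pos.2 hθm
  have hs' : Real.sqrt θm ≤ Real.sqrt θ' := Real.sqrt_le_sqrt hθ'
  have hdec : (Real.sqrt θ)⁻¹ • (v - u) - (Real.sqrt θ')⁻¹ • (v - u') =
      ((Real.sqrt θ)⁻¹ - (Real.sqrt θ')⁻¹) • (v - u) + (Real.sqrt θ')⁻¹ • (u' - u) := by
    simp only [sub_smul, smul_sub]; abel
  rw [hdec]
  refine (norm_add_le _ _).trans (add_le_add ?_ ?_)
  · rw [norm_smul, Real.norm_eq_abs]
    have h1 : ‖v - u‖ ≤ ‖v‖ + U := (norm_sub_le v u).trans (by linarith)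
    exact mul_le_mul hκ₁ h1 (norm_nonneg _) ((abs_nonneg _).trans hκ₁)
  · rw [norm_smul, norm_inv, Real.norm_eq_abs, abs_of_nonneg (Real.sqrt_nonneg _), norm_sub_rev]
    rw [div_eq_inv_mul]
    exact mul_le_mul (inv_anti₀ hsm hs') hκ ((norm_nonneg _)) (inv_nonneg.2 (Real.sqrt_nonneg _))

/-- **Tail detection in the primed frame**: if `‖v‖ > U + √θM R` then `‖(v − u')/√θ'‖ ≥ R` (`0 < θ' ≤ θM`, `‖u'‖ ≤ U`,
`R ≥ 0`). [folklore] -/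
theorem le_norm_frame_of_lt {θM U θ' R : ℝ} (hθ' : 0 < θ') (hθM : θ' ≤ θM) {u' : V3} (hu : ‖u'‖ ≤ U) (hR : 0 ≤ R)
    {v : V3} (hv : U + Real.sqrt θM * R < ‖v‖) :
    R ≤ ‖(Real.sqrt θ')⁻¹ • (v - u')‖ := by
  have hs' : 0 < Real.sqrt θ' := Real.sqrt_pos.2 hθ'
  have hsM : Real.sqrt θ' ≤ Real.sqrt θM := Real.sqrt_le_sqrt hθM
  rw [norm_smul, norm_inv, Real.norm_eq_abs, abs_of_nonneg hs'.le, inv_mul_eq_div, le_div_iff₀ hs']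
  have h1 : ‖v‖ - U ≤ ‖v - u'‖ := by
    have : ‖v‖ ≤ ‖v - u'‖ + ‖u'‖ := by
      calc ‖v‖ = ‖(v - u') + u'‖ := by rw [sub_add_cancel]
        _ ≤ ‖v - u'‖ + ‖u'‖ := norm_add_le _ _
    linarith
  have h2 : R * Real.sqrt θ' ≤ R * Real.sqrt θM := mul_le_mul_of_nonneg_left hsM hR
  nlinarith

/-- **Bulk detection in the unprimed frame**: if `‖v‖ ≤ Rv` then `‖(v − u)/√θ‖ ≤ (Rv + U)/√θm` (`θ ≥ θm > 0`,
`‖u‖ ≤ U`). [folklore] -/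
theorem norm_frame_le_of_le {θm U θ Rv : ℝ} (hθm : 0 < θm) (hθ : θm ≤ θ) {u : V3} (hu : ‖u‖ ≤ U) {v : V3}
    (hv : ‖v‖ ≤ Rv) :
    ‖(Real.sqrt θ)⁻¹ • (v - u)‖ ≤ (Rv + U) / Real.sqrt θm := by
  have hsm : 0 < Real.sqrt θm := Real.sqrt_pos.2 hθm
  have hs : Real.sqrt θm ≤ Real.sqrt θ := Real.sqrt_le_sqrt hθ
  rw [norm_smul, norm_inv, Real.norm_eq_abs, abs_of_nonneg (Real.sqrt_nonneg _), inv_mul_eq_div]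
  have h1 : ‖v - u‖ ≤ Rv + U := (norm_sub_le v u).trans (add_le_add hv hu)
  have h0 : 0 ≤ Rv + U := (norm_nonneg _).trans h1
  exact div_le_div₀ h0 h1 hsm hs

/-- **THE POINTWISE COMPARISON OF PRODUCT OBSERVABLES BETWEEN TWO NEARBY FRAMES.** Frames `(θ, u)`, `(θ', u')` at a
point with `θm ≤ θ, θ' ≤ θM`, `‖u‖, ‖u'‖ ≤ U`, `|(√θ)⁻¹ − (√θ')⁻¹| ≤ κ₁`, `‖u − u'‖ ≤ κ`; weights `|a'| ≤ 1`,
`|a − a'| ≤ ω`; a profile `g` with `|g w| ≤ c (1 + ‖w‖²)` and bulk modulus `|g w − g w'| ≤ η` whenever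
`‖w‖ ≤ (Rv + U)/√θm` and `‖w − w'‖ ≤ κ'`, where `Rv := U + √θM R` and `κ₁ (Rv + U) + κ/√θm ≤ κ'`; a tail weight `t ≥ 0`
with `t w = 1 + ‖w‖²` for `‖w‖ ≥ R` (`R ≥ 0`). Then, with `w̃ = (v − u)/√θ`, `w̃' = (v − u')/√θ'`:
`a g(w̃) − a' g(w̃') ≤ (ω c C₂ + η)(1 + ‖v‖²) + 2 c C₂ C₃ t(w̃')`. [folklore] -/
theorem observable_compare {θm θM U θ θ' κ κ₁ κ' ω η c R : ℝ} (hθm : 0 < θm) (hθ : θm ≤ θ) (hθ' : θm ≤ θ')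
    (hθM' : θ' ≤ θM) {u u' : V3} (hu : ‖u‖ ≤ U) (hu' : ‖u'‖ ≤ U)
    (hκ₁ : |(Real.sqrt θ)⁻¹ - (Real.sqrt θ')⁻¹| ≤ κ₁) (hκ : ‖u - u'‖ ≤ κ) (hκ₁0 : 0 ≤ κ₁)
    {a a' : ℝ} (ha' : |a'| ≤ 1) (haa : |a - a'| ≤ ω) (hη : 0 ≤ η) (hc : 0 ≤ c) (hR : 0 ≤ R)
    {g : V3 → ℝ} (hgb : ∀ w, |g w| ≤ c * (1 + ‖w‖ ^ 2))
    (hmod : ∀ w w', ‖w‖ ≤ (U + Real.sqrt θM * R + U) / Real.sqrt θm → ‖w - w'‖ ≤ κ' → |g w - g w'| ≤ η)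
    (hκ' : κ₁ * (U + Real.sqrt θM * R + U) + κ / Real.sqrt θm ≤ κ')
    {t : V3 → ℝ} (ht0 : ∀ w, 0 ≤ t w) (htR : ∀ w, R ≤ ‖w‖ → t w = 1 + ‖w‖ ^ 2) (v : V3) :
    a * g ((Real.sqrt θ)⁻¹ • (v - u)) - a' * g ((Real.sqrt θ')⁻¹ • (v - u')) ≤
      (ω * c * C₂ θm U + η) * (1 + ‖v‖ ^ 2) + 2 * c * C₂ θm U * C₃ θM U * t ((Real.sqrt θ')⁻¹ • (v - u')) := by
  set W : V3 := (Real.sqrt θ)⁻¹ • (v - u) with hW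
  set W' : V3 := (Real.sqrt θ')⁻¹ • (v - u') with hW'
  have hθ0' : 0 < θ' := hθm.trans_le hθ'
  have hC₂ : 1 ≤ C₂ θm U := one_le_C₂ (U := U) hθm
  have hC₃ : 1 ≤ C₃ θM U := one_le_C₃ (U := U) (hθ0'.trans_le hθM')
  have hv2 : 0 ≤ 1 + ‖v‖ ^ 2 := by positivity
  -- growth transfers
  have hgW : 1 + ‖W‖ ^ 2 ≤ C₂ θm U * (1 + ‖v‖ ^ 2) := one_add_norm_sq_frame_le hθm hθ hu v
  have hgW' : 1 + ‖W'‖ ^ 2 ≤ C₂ θm U * (1 + ‖v‖ ^ 2) := one_add_norm_sq_frame_le hθm hθ' hu' v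
  have hvW' : 1 + ‖v‖ ^ 2 ≤ C₃ θM U * (1 + ‖W'‖ ^ 2) := one_add_norm_sq_le_frame hθ0' hθM' hu' v
  -- first term: the weight difference
  have hω : 0 ≤ ω := (abs_nonneg _).trans haa
  have h1 : (a - a') * g W ≤ ω * c * C₂ θm U * (1 + ‖v‖ ^ 2) := by
    have : |(a - a') * g W| ≤ ω * (c * (1 + ‖W‖ ^ 2)) := by
      rw [abs_mul]; exact mul_le_mul haa (hgb W) (abs_nonneg _) hω
    refine (le_abs_self _).trans (this.trans ?_)
    have := mul_le_mul_of_nonneg_left hgW (mul_nonneg hω hc)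
    nlinarith
  -- second term: the frame difference, bulk or tail
  have h2 : a' * (g W - g W') ≤ η + 2 * c * C₂ θm U * C₃ θM U * t W' := by
    have ha'1 : |a'| * |g W - g W'| ≤ |g W - g W'| := by
      have := mul_le_mul_of_nonneg_right ha' (abs_nonneg (g W - g W'))
      rwa [one_mul] at this
    have hstep : a' * (g W - g W') ≤ |g W - g W'| :=
      (le_abs_self _).trans ((abs_mul _ _).le.trans ha'1)
    refine hstep.trans ?_
    by_cases hbulk : ‖v‖ ≤ U + Real.sqrt θM * R
    · -- bulk: the modulus applies
      have hWb : ‖W‖ ≤ (U + Real.sqrt θM * R + U) / Real.sqrt θm := norm_frame_le_of_le hθm hθ hu hbulk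
      have hWW' : ‖W - W'‖ ≤ κ' := by
        have h := norm_frame_sub_frame_le (θ := θ) hθm hθ' hu hκ₁ hκ v
        refine h.trans (le_trans ?_ hκ')
        have : ‖v‖ + U ≤ U + Real.sqrt θM * R + U := by linarith
        have := mul_le_mul_of_nonneg_left this hκ₁0
        linarith
      have := hmod W W' hWb hWW'
      have ht := ht0 W'
      have : 0 ≤ 2 * c * C₂ θm U * C₃ θM U * t W' := by
        have : 0 ≤ C₂ θm U := by linarith
        have : 0 ≤ C₃ θM U := by linarith
        positivity
      linarith
    · -- tail: quadratic envelopes in both frames, converted to `t W'`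
      push Not at hbulk
      have hRW' : R ≤ ‖W'‖ := le_norm_frame_of_lt hθ0' hθM' hu' hR hbulk
      have htW' : t W' = 1 + ‖W'‖ ^ 2 := htR W' hRW'
      have hdiff : |g W - g W'| ≤ c * (1 + ‖W‖ ^ 2) + c * (1 + ‖W'‖ ^ 2) :=
        (abs_sub _ _).trans (add_le_add (hgb W) (hgb W'))
      have e1 : c * (1 + ‖W‖ ^ 2) ≤ c * (C₂ θm U * (1 + ‖v‖ ^ 2)) := mul_le_mul_of_nonneg_left hgW hc
      have e2 : c * (1 + ‖W'‖ ^ 2) ≤ c * (C₂ θm U * (1 + ‖v‖ ^ 2)) := mul_le_mul_of_nonneg_left hgW' hc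
      have e3 : C₂ θm U * (1 + ‖v‖ ^ 2) ≤ C₂ θm U * (C₃ θM U * (1 + ‖W'‖ ^ 2)) :=
        mul_le_mul_of_nonneg_left hvW' (by linarith)
      rw [htW']
      nlinarith
  -- assemble
  have hsplit : a * g W - a' * g W' = (a - a') * g W + a' * (g W - g W') := by ring
  rw [hsplit]
  have hη' : η ≤ η * (1 + ‖v‖ ^ 2) := by nlinarith [sq_nonneg ‖v‖]
  nlinarith

/-- **The comparison in the averaged three-piece form consumed by the rank split.** Under the hypotheses of
`observable_compare` and a tail weight that splits as `t = t₀ + α + γ‖·‖²` with `|α|, |γ| ≤ ηt`: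
`2 (a g(w̃)) ≤ 3⁻¹ (6 a' g(w̃') + 6Λ (1 + ‖v‖²) + 12 c C₂ C₃ t₀(w̃'))` with
`Λ := ω c C₂ + η + 2 c C₂ C₃ ηt (1 + C₂)`. [folklore] -/
theorem observable_compare_avg {θm θM U θ θ' κ κ₁ κ' ω η ηt c R α γ : ℝ} (hθm : 0 < θm) (hθ : θm ≤ θ)
    (hθ' : θm ≤ θ') (hθM' : θ' ≤ θM) {u u' : V3} (hu : ‖u‖ ≤ U) (hu' : ‖u'‖ ≤ U)
    (hκ₁ : |(Real.sqrt θ)⁻¹ - (Real.sqrt θ')⁻¹| ≤ κ₁) (hκ : ‖u - u'‖ ≤ κ) (hκ₁0 : 0 ≤ κ₁)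
    {a a' : ℝ} (ha' : |a'| ≤ 1) (haa : |a - a'| ≤ ω) (hη : 0 ≤ η) (hc : 0 ≤ c) (hR : 0 ≤ R)
    {g : V3 → ℝ} (hgb : ∀ w, |g w| ≤ c * (1 + ‖w‖ ^ 2))
    (hmod : ∀ w w', ‖w‖ ≤ (U + Real.sqrt θM * R + U) / Real.sqrt θm → ‖w - w'‖ ≤ κ' → |g w - g w'| ≤ η)
    (hκ' : κ₁ * (U + Real.sqrt θM * R + U) + κ / Real.sqrt θm ≤ κ')
    {t t₀ : V3 → ℝ} (ht0 : ∀ w, 0 ≤ t w) (htR : ∀ w, R ≤ ‖w‖ → t w = 1 + ‖w‖ ^ 2)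
    (hsplit : ∀ w, t w = t₀ w + (α + γ * ‖w‖ ^ 2)) (hα : |α| ≤ ηt) (hγ : |γ| ≤ ηt) (v : V3) :
    2 * (a * g ((Real.sqrt θ)⁻¹ • (v - u))) ≤
      (3 : ℝ)⁻¹ * (6 * (a' * g ((Real.sqrt θ')⁻¹ • (v - u'))) +
        6 * (ω * c * C₂ θm U + η + 2 * c * C₂ θm U * C₃ θM U * ηt * (1 + C₂ θm U)) * (1 + ‖v‖ ^ 2) +
        12 * c * C₂ θm U * C₃ θM U * t₀ ((Real.sqrt θ')⁻¹ • (v - u'))) := by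
  have hmain := observable_compare hθm hθ hθ' hθM' hu hu' hκ₁ hκ hκ₁0 ha' haa hη hc hR hgb hmod hκ' ht0 htR v
  set W' : V3 := (Real.sqrt θ')⁻¹ • (v - u') with hW'
  have hθ0' : 0 < θ' := hθm.trans_le hθ'
  have hC₂ : 1 ≤ C₂ θm U := one_le_C₂ (U := U) hθm
  have hC₃ : 1 ≤ C₃ θM U := one_le_C₃ (U := U) (hθ0'.trans_le hθM')
  have hgW' : 1 + ‖W'‖ ^ 2 ≤ C₂ θm U * (1 + ‖v‖ ^ 2) := one_add_norm_sq_frame_le hθm hθ' hu' v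
  have hηt : 0 ≤ ηt := (abs_nonneg _).trans hα
  -- the projection remainder is a small quadratic weight
  have hrem : α + γ * ‖W'‖ ^ 2 ≤ ηt * (1 + C₂ θm U) * (1 + ‖v‖ ^ 2) := by
    have h1 : α ≤ ηt := (le_abs_self α).trans hα
    have h2 : γ * ‖W'‖ ^ 2 ≤ ηt * ‖W'‖ ^ 2 :=
      mul_le_mul_of_nonneg_right ((le_abs_self γ).trans hγ) (sq_nonneg _)
    have h3 : ‖W'‖ ^ 2 ≤ C₂ θm U * (1 + ‖v‖ ^ 2) := by nlinarith [sq_nonneg ‖W'‖]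
    have h4 : ηt * ‖W'‖ ^ 2 ≤ ηt * (C₂ θm U * (1 + ‖v‖ ^ 2)) := mul_le_mul_of_nonneg_left h3 hηt
    have h5 : ηt ≤ ηt * (1 + ‖v‖ ^ 2) := by nlinarith [sq_nonneg ‖v‖]
    nlinarith
  have htt : t W' = t₀ W' + (α + γ * ‖W'‖ ^ 2) := hsplit W'
  have hK : 0 ≤ 2 * c * C₂ θm U * C₃ θM U := by
    have : 0 ≤ C₂ θm U := by linarith
    have : 0 ≤ C₃ θM U := by linarith
    positivity
  have key : 2 * c * C₂ θm U * C₃ θM U * t W' ≤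
      2 * c * C₂ θm U * C₃ θM U * t₀ W' + 2 * c * C₂ θm U * C₃ θM U * (ηt * (1 + C₂ θm U) * (1 + ‖v‖ ^ 2)) := by
    rw [htt, mul_add]
    have := mul_le_mul_of_nonneg_left hrem hK
    linarith
  nlinarith

/-! ## §4 The registered helper statement of this file -/

/-- Helper statement `FamilyGlueComparison` (helper stub `stub_familyGlueComparison` of `stub_familyGlue`, line
rare-band-ladder-dock v7, file 1 of 2): the pointwise three-piece comparison of thermal-frame product observables
between two nearby frames within a temperature range `[θm, θM]` and drift bound `U` — route-internal, not a cited
fact. -/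
def FamilyGlueComparison : Prop :=
  ∀ (θm θM U θ θ' κ κ₁ κ' ω η ηt c R α γ : ℝ) (u u' : V3) (a a' : ℝ) (g t t₀ : V3 → ℝ) (v : V3),
    0 < θm → θm ≤ θ → θm ≤ θ' → θ' ≤ θM → ‖u‖ ≤ U → ‖u'‖ ≤ U →
    |(Real.sqrt θ)⁻¹ - (Real.sqrt θ')⁻¹| ≤ κ₁ → ‖u - u'‖ ≤ κ → 0 ≤ κ₁ → |a'| ≤ 1 → |a - a'| ≤ ω →
    0 ≤ η → 0 ≤ c → 0 ≤ R →
    (∀ w, |g w| ≤ c * (1 + ‖w‖ ^ 2)) →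
    (∀ w w', ‖w‖ ≤ (U + Real.sqrt θM * R + U) / Real.sqrt θm → ‖w - w'‖ ≤ κ' → |g w - g w'| ≤ η) →
    κ₁ * (U + Real.sqrt θM * R + U) + κ / Real.sqrt θm ≤ κ' →
    (∀ w, 0 ≤ t w) → (∀ w, R ≤ ‖w‖ → t w = 1 + ‖w‖ ^ 2) →
    (∀ w, t w = t₀ w + (α + γ * ‖w‖ ^ 2)) → |α| ≤ ηt → |γ| ≤ ηt →
    2 * (a * g ((Real.sqrt θ)⁻¹ • (v - u))) ≤
      (3 : ℝ)⁻¹ * (6 * (a' * g ((Real.sqrt θ')⁻¹ • (v - u'))) +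
        6 * (ω * c * C₂ θm U + η + 2 * c * C₂ θm U * C₃ θM U * ηt * (1 + C₂ θm U)) * (1 + ‖v‖ ^ 2) +
        12 * c * C₂ θm U * C₃ θM U * t₀ ((Real.sqrt θ')⁻¹ • (v - u')))

/-- **Registered helper stub `stub_familyGlueComparison`** (helper of `stub_familyGlue`, line rare-band-ladder-dock v7,
file 1 of 2): `FamilyGlueComparison` holds (`observable_compare_avg`). [folklore] -/
theorem stub_familyGlueComparison : FamilyGlueComparison :=
  fun _ _ _ _ _ _ _ _ _ _ _ _ _ _ _ _ _ _ _ _ _ _ v hθm hθ hθ' hθM' hu hu' hκ₁ hκ hκ₁0 ha' haa hη hc hR hgb hmod hκ'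
      ht0 htR hsplit hα hγ =>
    observable_compare_avg hθm hθ hθ' hθM' hu hu' hκ₁ hκ hκ₁0 ha' haa hη hc hR hgb hmod hκ' ht0 htR hsplit hα hγ v

end Summit.AtomisticToContinuum.HydrodynamicLimit.Theorems.KineticWindowGronwallFamilyGlue

end
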